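import Summits.QuantumFields.BalabanUV.T4Continuum.Spine.NE3.LandauCorrectionSupB8LocalGauge
import Summits.QuantumFields.BalabanUV.T4Continuum.Support.NE3AxialGaugeLadder
import HarnessLib

/-!
# T⁴ programme, node NE3 — census R39 (brick (i), file 3): THE AXIAL-GAUGE DIVERGENCE BOUND `‖div(W^{axial} − 1)‖ ≤ 2d²(R+1)·x₁ + 8d³(R+1)²·x²` ON A CUBE, AND
# THE CURVED (H0_W) ∕ THE END's `hK(W)` FROM THE PLAQUETTE RADIUS `x`, THE COVARIANT PLAQUETTE-GRADIENT RADIUS `x₁` AND ONE k-FREE LINE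

Cell `pub-balaban-gaps` (YM blitz, track G2, seat `ne3`, unit `pub-balaban-gaps-ne3-g8`; writer prover-pub-balaban-gaps-ne3-g8-0, 2026-08-24), census
`run/shared/lean/pub/pub-balaban-gaps/ne/NE3.md` §4 R39, §14.  The chain: R37 (`NE3DiscreteGradientEstimate`: lattice maximum principle) → `SupRegularityLocalGauge` (perturbation in
a near-identity gauge) → `LandauCorrectionSupB8LocalGauge.supRegularity_of_axialDivergence` ((H0_W) ⇐ the axial-gauge divergence bound `δ`) → files 1–2 of brick (i)
(`NE3LadderCovariantDifference`, `NE3AxialGaugeLadder`: two consecutive `μ`-bonds in the axial gauge differ by `≤ |Q|x₁ + 2|Q|²x²`).  THIS FILE closes it: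
* §1 **`norm_axialDivergence_le`** — for unitary `W` with `SmallField W x` and covariant plaquette gradients `≤ x₁`, on the sup-cube of radius `R` about `y₀` the lattice
  divergence of `E = W^{axialFn W (y₀ − (R+1)𝟙)} − 1` satisfies `‖Σ_ν(E(y,ν) − E(y−e_ν,ν))‖ ≤ 2d²(R+1)·x₁ + 8d³(R+1)²·x²` (`|Q| ≤ |y − base|₁ ≤ 2d(R+1)` per direction).
* §2 **`supRegularity_of_plaqGrad`** — (H0_W) IN THE MULTI-LEVEL SMALL-FIELD CLASS FROM KINEMATIC DATA OF THE BACKGROUND ALONE: `u ∈ N(Q′(W))`, `‖Δ_Wu‖_∞ ≤ B` ⟹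
  `‖D_Wu‖_∞ ≤ 4R·B`, `‖u‖_∞ ≤ 4(frameC d L + d)M·R·B`, given `SmallField W x`, the plaquette-gradient radius `x₁` and the line
  `2dC_U∕R + (4Rδ + 24Rda² + 2a)C_U + 8Rda ≤ ½` with `a = 2d(R+1)x`, `δ = 2d²(R+1)x₁ + 8d³(R+1)²x²`, `C_U = (frameC d L + d)M` — with `R = rM` it reads `M²x`, `M³x₁` SMALL,
  k-free (the class has `x = ε∕M²`; `x₁ ≍ c∕M³` is [B11] Thm 1 (10) ∕ [B8] (1.34) TYPE regularity of the background).
* §3 **`landauCorrectionSupB8_of_plaqGrad`** — THE END's per-pair `hK(W)` ⇐ plaquette-gradient radius `x₁` ∧ line ∧ (HR_W): the [B9] (3.42)-TYPE binder (H0_W) of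
  `PairLandauB8EndSupFacts` is DISCHARGED into kinematics + a (1.34)-TYPE regularity datum of `W`.

CONTENT (0 sorry; no `def`; [folklore]).  HONEST FRAMING.  (H0_W) is now proved for every unitary periodic background with small plaquettes AND small covariant plaquette gradients
(under the displayed line); NOT discharged: the plaquette-gradient radius of the END's backgrounds `W = cavg L U_B` (regularity transport through one averaging), (HR_W), (P♮) at curved `W`,
`PairLandauGaugeB8Avg`; the covariant root and **NE3 are NOT proved**; spine PROVED 0∕9; finite T⁴ rung (B)+1 — NOT infinite volume, NOT mass gap, NOT `BetaPertH`, NOT Clay.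
PLACEMENT: `Summits/QuantumFields/BalabanUV/T4Continuum/Spine/NE3/`; imports accepted modules only.
-/

set_option autoImplicit false

open scoped BigOperators Matrix Matrix.Norms.L2Operator
open NormedSpace Finset

namespace Summit.QuantumFields.BalabanUV.T4Continuum.NE3.AxialGaugeDivergence

open Literature.MathematicalPhysics.QuantumFieldTheory.Balaban1983to89
open B7Prop1Explicit B7Prop2Explicit
open B8Lemma1NonAbelian (lowPart)
open B8Ineq129 (l1_lowPart_le)
open T4AveragingDeficitWall (Ad IsUnitaryCfg SmallField)
open T4AveragingDeficitWallBoundary (IsPeriodicCfg periodBox)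
open AveragingDeficitMultiLevelPrep (LevelSmall)
open BlockAveragePushDirGauge (gaugeDir)
open NE3QbarIterCovLiftPrep (cruxC liftC)
open NE3CovariantCalculus (hsR)
open NE3RightInverseSupLetters (frameC)
open NE3.PairLandauB8 (avgKernelGauges covLapSite)
open NE3.LandauProjectionSupShape (LandauCorrectionSupB8)
open NE3.LandauCorrectionSupB8LocalGauge (supRegularity_of_axialDivergence landauCorrectionSupB8_of_axialDivergence)
open NE3AxialGaugeLadder (norm_axial_bond_sub_bond_le)

noncomputable section

variable {d : ℕ} {n : Type*} [Fintype n] [DecidableEq n]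

/-! ## §1 The axial-gauge divergence on a cube -/

/-- **THE AXIAL-GAUGE DIVERGENCE BOUND ON A CUBE**: for unitary `W` with `SmallField W x` (`x ≥ 0`) and covariant plaquette gradients `≤ x₁`, every `y₀`, `R` and every `y` with
`|y_i − y₀,i| ≤ R`: `‖Σ_ν((V₀(y,ν) − 1) − (V₀(y−e_ν,ν) − 1))‖ ≤ 2d²(R+1)·x₁ + 8d³(R+1)²·x²`, `V₀ = W^{axialFn W (y₀ − (R+1)𝟙)}`. [folklore] -/
theorem norm_axialDivergence_le [Nonempty n] {W : Site d → Fin d → (Matrix n n ℂ)ˣ} (hWu : IsUnitaryCfg W) {x x₁ : ℝ} (hx0 : 0 ≤ x) (hx10 : 0 ≤ x₁)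
    (hWx : SmallField W x)
    (hgrad : ∀ (p : Site d) (μ κ : Fin d), κ ≠ μ →
      ‖Ad (W p μ) ((hol W (p + e μ) (plaqWord κ μ) : (Matrix n n ℂ)ˣ) : Matrix n n ℂ) - ((hol W p (plaqWord κ μ) : (Matrix n n ℂ)ˣ) : Matrix n n ℂ)‖ ≤ x₁)
    (y₀ : Site d) (R : ℕ) (y : Site d) (hy : ∀ i, |y i - y₀ i| ≤ (R : ℤ)) :
    ‖∑ ν : Fin d, ((((gaugeAct (axialFn W (y₀ - fun _ => (R : ℤ) + 1)) W y ν : (Matrix n n ℂ)ˣ) : Matrix n n ℂ) - 1)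
        - (((gaugeAct (axialFn W (y₀ - fun _ => (R : ℤ) + 1)) W (y - e ν) ν : (Matrix n n ℂ)ˣ) : Matrix n n ℂ) - 1))‖
      ≤ 2 * (d : ℝ) ^ 2 * (R + 1) * x₁ + 8 * (d : ℝ) ^ 3 * ((R : ℝ) + 1) ^ 2 * x ^ 2 := by
  set yb : Site d := y₀ - fun _ => (R : ℤ) + 1 with hyb
  -- the generic bound per direction
  have hQ : ∀ ν : Fin d, (l1 (lowPart ν (y - yb)) : ℝ) ≤ 2 * (d : ℝ) * (R + 1) := by
    intro ν
    have h3 : l1 (lowPart ν (y - yb)) ≤ l1 (y - yb) := l1_lowPart_le ν _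
    have h4 : l1 (y - yb) ≤ d * (2 * R + 2) := by
      unfold l1
      calc ∑ i, ((y - yb) i).natAbs ≤ ∑ _i : Fin d, (2 * R + 2) := Finset.sum_le_sum fun i _ => by
              have h1 := abs_le.mp (hy i)
              have e1 : (y - yb) i = y i - y₀ i + ((R : ℤ) + 1) := by rw [hyb]; simp; ring
              rw [e1]; omega
        _ = d * (2 * R + 2) := by simp
    have h6 : ((l1 (lowPart ν (y - yb)) : ℕ) : ℝ) ≤ ((d * (2 * R + 2) : ℕ) : ℝ) := by exact_mod_cast h3.trans h4
    refine h6.trans (le_of_eq ?_); push_cast; ring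
  have hterm : ∀ ν : Fin d, ‖(((gaugeAct (axialFn W yb) W y ν : (Matrix n n ℂ)ˣ) : Matrix n n ℂ) - 1)
      - (((gaugeAct (axialFn W yb) W (y - e ν) ν : (Matrix n n ℂ)ˣ) : Matrix n n ℂ) - 1)‖ ≤ 2 * (d : ℝ) * (R + 1) * x₁ + 8 * (d : ℝ) ^ 2 * ((R : ℝ) + 1) ^ 2 * x ^ 2 := by
    intro ν
    have hyν : yb ≤ y - e ν := by
      intro i; have h1 := (abs_le.mp (hy i)).1
      show y₀ i - ((R : ℤ) + 1) ≤ (y - e ν) i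
      rw [Pi.sub_apply, e_apply]; split_ifs <;> linarith
    rw [sub_sub_sub_cancel_right]
    refine (norm_axial_bond_sub_bond_le hWu hx0 hWx hgrad yb y ν hyν).trans ?_
    have hq := hQ ν
    have hq0 : (0 : ℝ) ≤ l1 (lowPart ν (y - yb)) := Nat.cast_nonneg _
    have h1 : (l1 (lowPart ν (y - yb)) : ℝ) * x₁ ≤ (2 * (d : ℝ) * (R + 1)) * x₁ := mul_le_mul_of_nonneg_right hq hx10
    have h2 : (l1 (lowPart ν (y - yb)) : ℝ) ^ 2 ≤ (2 * (d : ℝ) * (R + 1)) ^ 2 := pow_le_pow_left₀ hq0 hq 2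
    have h3 : 2 * (l1 (lowPart ν (y - yb)) : ℝ) ^ 2 * x ^ 2 ≤ 2 * (2 * (d : ℝ) * (R + 1)) ^ 2 * x ^ 2 :=
      mul_le_mul_of_nonneg_right (mul_le_mul_of_nonneg_left h2 (by norm_num)) (sq_nonneg x)
    have h4 : 2 * (2 * (d : ℝ) * (R + 1)) ^ 2 * x ^ 2 = 8 * (d : ℝ) ^ 2 * ((R : ℝ) + 1) ^ 2 * x ^ 2 := by ring
    linarith
  calc _ ≤ ∑ ν : Fin d, ‖(((gaugeAct (axialFn W yb) W y ν : (Matrix n n ℂ)ˣ) : Matrix n n ℂ) - 1)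
            - (((gaugeAct (axialFn W yb) W (y - e ν) ν : (Matrix n n ℂ)ˣ) : Matrix n n ℂ) - 1)‖ := norm_sum_le _ _
    _ ≤ ∑ _ν : Fin d, (2 * (d : ℝ) * (R + 1) * x₁ + 8 * (d : ℝ) ^ 2 * ((R : ℝ) + 1) ^ 2 * x ^ 2) := Finset.sum_le_sum fun ν _ => hterm ν
    _ = 2 * (d : ℝ) ^ 2 * (R + 1) * x₁ + 8 * (d : ℝ) ^ 3 * ((R : ℝ) + 1) ^ 2 * x ^ 2 := by
        rw [Finset.sum_const, Finset.card_univ, Fintype.card_fin, nsmul_eq_mul]; ring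

/-! ## §2 (H0_W) in the class from the plaquette radius and the plaquette-gradient radius -/

/-- **(H0_W) IN THE MULTI-LEVEL SMALL-FIELD CLASS FROM KINEMATIC DATA OF THE BACKGROUND** (`d ≥ 1`, `L ≥ 2`, `N ≥ 1`, level `j`, `M = L^{j+1}`): for a unitary `(N·M)`-periodic
`W` with `LevelSmall d L j x`, `SmallField W x` and covariant plaquette gradients `≤ x₁`, every `u ∈ avgKernelGauges L N (j+1) W` with `‖Δ_Wu‖_∞ ≤ B` has
`‖D_Wu‖_∞ ≤ 4R·B` and `‖u‖_∞ ≤ 4(frameC d L + d)M·R·B`, provided the line (with `a = 2d(R+1)x`, `δ = 2d²(R+1)x₁ + 8d³(R+1)²x²`, `C_U = (frameC d L + d)M`) holds. [folklore] -/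
theorem supRegularity_of_plaqGrad [Nonempty n] (hd : 1 ≤ d) {L N : ℕ} [NeZero N] (hL : 2 ≤ L) (j : ℕ)
    {W : Site d → Fin d → (Matrix n n ℂ)ˣ} {x x₁ : ℝ} (hWu : IsUnitaryCfg W) (hWP : IsPeriodicCfg W ((N * L ^ (j + 1) : ℕ) : ℤ))
    (hx : 0 ≤ x) (hs : LevelSmall d L j x) (hWx : SmallField W x) (hx10 : 0 ≤ x₁)
    (hgrad : ∀ (p : Site d) (μ κ : Fin d), κ ≠ μ →
      ‖Ad (W p μ) ((hol W (p + e μ) (plaqWord κ μ) : (Matrix n n ℂ)ˣ) : Matrix n n ℂ) - ((hol W p (plaqWord κ μ) : (Matrix n n ℂ)ˣ) : Matrix n n ℂ)‖ ≤ x₁)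
    {u : Site d → Matrix n n ℂ} (hu : u ∈ avgKernelGauges (d := d) (n := n) L N (j + 1) W) {B : ℝ} (hB : ∀ y : Site d, ‖covLapSite W u y‖ ≤ B)
    {R : ℕ} (hR : 1 ≤ R)
    (hline : 2 * (d : ℝ) * ((frameC d L + d) * (L : ℝ) ^ (j + 1)) / R
        + (4 * R * (2 * (d : ℝ) ^ 2 * (R + 1) * x₁ + 8 * (d : ℝ) ^ 3 * ((R : ℝ) + 1) ^ 2 * x ^ 2)
            + 24 * R * d * (2 * (d : ℝ) * (R + 1) * x) ^ 2 + 2 * (2 * (d : ℝ) * (R + 1) * x)) * ((frameC d L + d) * (L : ℝ) ^ (j + 1))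
        + 8 * R * d * (2 * (d : ℝ) * (R + 1) * x) ≤ 1 / 2) :
    (∀ (y : Site d) (μ : Fin d), ‖gaugeDir W u y μ‖ ≤ 4 * R * B) ∧
      (∀ y : Site d, ‖u y‖ ≤ 4 * ((frameC d L + d) * (L : ℝ) ^ (j + 1)) * R * B) :=
  supRegularity_of_axialDivergence hd hL j hWu hWP hx hs hWx hu hB hR
    (fun y₀ y hy => norm_axialDivergence_le hWu hx hx10 hWx hgrad y₀ R y hy) hline

/-! ## §3 THE END's `hK(W)` from the plaquette-gradient radius and (HR_W) -/

/-- **THE END's SUP LETTER `hK` AT A CURVED BACKGROUND OF THE CLASS FROM THE PLAQUETTE-GRADIENT RADIUS AND (HR_W)** (`d ≥ 1`, `L ≥ 2`, `N ≥ 1`, `j`; `M = L^{j+1}`,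
`θ = cruxC·M²x < 1`): `LandauCorrectionSupB8 hL j hWu hx hs hWx N hθ K₀ K₁` with `K₀ = d·liftC(6 + 2(d+1)M²x)·(4(frameC+d)R∕M)·c_R∕(1−θ)`, `K₁ = … ·(4R∕M)·…` ⇐ covariant
plaquette gradients `≤ x₁` ∧ the line of §2 ∧ (HR_W).  The [B9] (3.42)-TYPE binder (H0_W) of `PairLandauB8EndSupFacts` is thereby replaced by a [B8] (1.34) ∕ [B11] Thm 1 (10)-TYPE
regularity datum of `W` plus kinematics. [folklore] -/
theorem landauCorrectionSupB8_of_plaqGrad [Nonempty n] (hd : 1 ≤ d) {L : ℕ} (hL : 2 ≤ L) (j : ℕ)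
    {W : Site d → Fin d → (Matrix n n ℂ)ˣ} {x x₁ : ℝ} (hWu : IsUnitaryCfg W) (hx : 0 ≤ x) (hs : LevelSmall d L j x) (hWx : SmallField W x)
    (N : ℕ) [NeZero N] (hθ : cruxC d L * (((L : ℝ) ^ (j + 1)) ^ 2 * x) < 1) (hWP : IsPeriodicCfg W ((N * L ^ (j + 1) : ℕ) : ℤ)) (hx10 : 0 ≤ x₁)
    (hgrad : ∀ (p : Site d) (μ κ : Fin d), κ ≠ μ →
      ‖Ad (W p μ) ((hol W (p + e μ) (plaqWord κ μ) : (Matrix n n ℂ)ˣ) : Matrix n n ℂ) - ((hol W p (plaqWord κ μ) : (Matrix n n ℂ)ˣ) : Matrix n n ℂ)‖ ≤ x₁)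
    {R : ℕ} (hR : 1 ≤ R) {cR : ℝ}
    (hline : 2 * (d : ℝ) * ((frameC d L + d) * (L : ℝ) ^ (j + 1)) / R
        + (4 * R * (2 * (d : ℝ) ^ 2 * (R + 1) * x₁ + 8 * (d : ℝ) ^ 3 * ((R : ℝ) + 1) ^ 2 * x ^ 2)
            + 24 * R * d * (2 * (d : ℝ) * (R + 1) * x) ^ 2 + 2 * (2 * (d : ℝ) * (R + 1) * x)) * ((frameC d L + d) * (L : ℝ) ^ (j + 1))
        + 8 * R * d * (2 * (d : ℝ) * (R + 1) * x) ≤ 1 / 2)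
    (hRW : ∀ (F : Site d → Matrix n n ℂ), (∀ y : Site d, F y ∈ skewAdjoint (Matrix n n ℂ)) →
      (∀ (y : Site d) (i : Fin d), F (y + ((N * L ^ (j + 1) : ℕ) : ℤ) • e i) = F y) →
      ∀ μ ∈ avgKernelGauges (d := d) (n := n) L N (j + 1) W,
        (∀ ν ∈ avgKernelGauges (d := d) (n := n) L N (j + 1) W,
          ∑ y ∈ periodBox (d := d) (N * L ^ (j + 1)), hsR (F y + covLapSite W μ y) (covLapSite W ν y) = 0) →
        ∀ B : ℝ, (∀ y : Site d, ‖F y‖ ≤ B) → ∀ y : Site d, ‖covLapSite W μ y‖ ≤ cR * B) :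
    LandauCorrectionSupB8 hL j hWu hx hs hWx N hθ
      ((d : ℝ) * liftC d * (6 + 2 * ((d : ℝ) + 1) * (((L : ℝ) ^ (j + 1)) ^ 2 * x)) * (4 * (frameC d L + d) * R / (L : ℝ) ^ (j + 1)) * cR
        / (1 - cruxC d L * (((L : ℝ) ^ (j + 1)) ^ 2 * x)))
      ((d : ℝ) * liftC d * (6 + 2 * ((d : ℝ) + 1) * (((L : ℝ) ^ (j + 1)) ^ 2 * x)) * (4 * R / (L : ℝ) ^ (j + 1)) * cR
        / (1 - cruxC d L * (((L : ℝ) ^ (j + 1)) ^ 2 * x))) :=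
  landauCorrectionSupB8_of_axialDivergence hd hL j hWu hx hs hWx N hθ hWP hR
    (fun y₀ y hy => norm_axialDivergence_le hWu hx hx10 hWx hgrad y₀ R y hy) hline hRW

end

end Summit.QuantumFields.BalabanUV.T4Continuum.NE3.AxialGaugeDivergence
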